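import Summits.QuantumFields.GaugeBoot.BootstrapTranslationReductionZd
import Summits.QuantumFields.GaugeBoot.PolynomialFunctionalsRealisable
import HarnessLib

/-!
# The translation-reduced bootstrap on `ℤ^d` converges to the translation-invariant Gibbs states (gauge-boot, L1/L4 supplement)

HONEST FRAMING (cell `pub-gaugeboot`, page 1 of every file): the venture produces certified bounds
on lattice expectations at stated coupling, gauge group, dimension and torus size; NOT a mass gap,
NOT a continuum limit, NOT a string tension; NOT Yang–Mills-summit-bearing (barriers
`FixedCouplingUltralocality`, `PerturbativeInvisibility`). Structural; it certifies no number
and says nothing about RATES.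

## Content

`BootstrapConvergence.bootstrap_convergence_dlr_suN`: the PLAIN level-`n` values of a polynomial
observable on `ℤ^d` are eventually within `ε` of `{∫ P dμ : μ a Gibbs state}`. Here the same for a
bootstrap with IMPOSED INVARIANCE under a family of configuration maps preserving the polynomial
observables — the limit solutions inherit the invariance:

* ★★ `bootstrap_convergence_invariant` (any lattice, compact `G`, exponential one-link shifts,
  polynomial local actions, any truncation scheme, any family `𝓡` of polynomial-preserving maps):
  for `n` large every level-`n` feasible functional invariant on `V n` under `𝓡` is within `ε` on
  `P` of an UNTRUNCATED solution invariant under `𝓡` on all polynomial observables (Tychonoff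
  cluster point; invariance is a closed, eventually imposed constraint);
* ★★★ `symBootstrap_convergence_dlr_suN` — `SU(N)` on `ℤ^d`, any real `β`: for every polynomial
  observable `P` and `ε > 0` there is a level `n` such that every value of the TRANSLATION-REDUCED
  level-`n` SDP (`symLevelValuesZdSuN`, Wilson loops modulo translations — Anderson–Kruczenski,
  Kazakov–Zheng) lies within `ε` of `∫ P dμ` for some TRANSLATION-INVARIANT infinite-volume Gibbs
  state `μ`. With soundness (`dlr_integral_mem_symLevelValuesZd`): the reduced hierarchy converges
  to exactly the range of `P` over the homogeneous phases, the plain hierarchy to its range over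
  all phases;
* ★★ `exists_translationInvariant_dlr_of_dlr_suN` — averaging ANY Gibbs state by the invariant
  mean (`translationAvg` of its expectation functional, untruncated feasibility transfer, the DLR
  realisation `exists_dlr_of_bootstrap_suN`) gives a translation-invariant Gibbs state whose
  polynomial expectations are the invariant means `zdMean (v ↦ ∫ P ∘ τ_v dμ)`; in particular
  (`exists_translationInvariant_dlr_suN`) translation-invariant Gibbs states exist at every `β`
  (a second proof; the tree has them as torus limit points).

What this is NOT: whether non-invariant Gibbs states with larger `∫ P dμ` exist at some `β`
(translation-symmetry breaking) is not addressed — where all Gibbs states are translation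
invariant (e.g. the strong-coupling uniqueness window) the two hierarchies have the same limit;
no rates; no statement at fixed level beyond `BootstrapTranslationReductionZd`.

References: P. Anderson, M. Kruczenski, Nucl. Phys. B 921 (2017); V. Kazakov, Z. Zheng,
arXiv:2203.11360; H.-O. Georgii, Gibbs Measures and Phase Transitions (2011) Ch. 4–5, 7
(existence and averaging of shift-invariant Gibbs measures). Folklore.
-/

noncomputable section

open MeasureTheory Filter Topology NormedSpace
open Literature.MathematicalPhysics.QuantumFieldTheory (LatticeRep)
open Literature.MathematicalPhysics.QuantumLattice

namespace Summit.QuantumFields.GaugeBoot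

/-! ## Convergence with imposed invariance (general) -/

section General

variable {ι : Type*} [DecidableEq ι] {G : Type*} [Group G] [TopologicalSpace G]
  [IsTopologicalGroup G] (r : LatticeRep G) {K : Type*}
  {k : K → ℝ → G} {X : K → Matrix (Fin r.N) (Fin r.N) ℂ} {S : ι → (ι → G) → ℝ} {β : ℝ}

/-- ★★ **Convergence of a truncated bootstrap with imposed invariance.** Exponential one-link
shifts, polynomial local actions, any truncation scheme `V n` eventually containing each polynomial
observable, any family `𝓡` of configuration maps preserving the polynomial observables. For every
polynomial `P` and `ε > 0` there is a level `n` such that every level-`n` feasible functional which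
is invariant under `𝓡` on `V n` gives `P` a value within `ε` of `ψ P` for some solution `ψ` of the
UNTRUNCATED bootstrap invariant under `𝓡` on all polynomial observables. (As
`bootstrap_convergence`: a cluster point in the product topology; each invariance constraint is
closed and eventually imposed.) [folklore] -/
theorem bootstrap_convergence_invariant (hk : ∀ a s t, k a (s + t) = k a s * k a t)
    (hX : ∀ a t, r.ρ (k a t) = exp ((t : ℂ) • X a)) (hS : ∀ i, S i ∈ polyFunctions (ι := ι) r)
    (V : ℕ → Set C(ι → G, ℝ)) (hex : ∀ a ∈ polyAlgebra (ι := ι) r, ∀ᶠ n in atTop, a ∈ V n)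
    (𝓡 : Set C(ι → G, ι → G))
    (h𝓡 : ∀ R ∈ 𝓡, ∀ a ∈ polyAlgebra (ι := ι) r, a.comp R ∈ polyAlgebra (ι := ι) r)
    {P : C(ι → G, ℝ)} (hP : P ∈ polyAlgebra (ι := ι) r) {ε : ℝ} (hε : 0 < ε) :
    ∃ n, ∀ φ : C(ι → G, ℝ) →ₗ[ℝ] ℝ, IsBootstrapFeasible r k S β (V n) φ →
      (∀ R ∈ 𝓡, ∀ a ∈ V n, φ (a.comp R) = φ a) →
      ∃ ψ : C(ι → G, ℝ) →ₗ[ℝ] ℝ,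
        IsBootstrapFeasible r k S β (polyAlgebra (ι := ι) r : Set C(ι → G, ℝ)) ψ ∧
        (∀ R ∈ 𝓡, ∀ a ∈ polyAlgebra (ι := ι) r, ψ (a.comp R) = ψ a) ∧ |φ P - ψ P| ≤ ε := by
  classical
  by_contra hcon
  push Not at hcon
  choose φ hφ hinv hfar using hcon
  -- the polynomial derivatives of the local actions
  have hS'ex : ∀ (i : ι) (a : K), ∃ S' ∈ polyAlgebra (ι := ι) r,
      ∀ U, HasDerivAt (fun t => S i (Function.update U i (k a t * U i))) (S' U) 0 := fun i a => by
    obtain ⟨S₀, hS₀, hS₀e⟩ := (mem_polyFunctions_iff r).1 (hS i)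
    obtain ⟨S', hS'm, hS'⟩ := exists_deriv_mem_polyAlgebra r (hk a) (hX a) i hS₀
    exact ⟨S', hS'm, by rw [← hS₀e]; exact hS'⟩
  choose S' hS'm hS'd using hS'ex
  -- archimedean bounds: each polynomial is bounded by finitely many PSD constraints
  have hb : ∀ a : C(ι → G, ℝ), ∃ (C : ℝ) (s : Finset C(ι → G, ℝ)), a ∈ polyAlgebra (ι := ι) r →
      (∀ v ∈ s, v ∈ polyAlgebra (ι := ι) r) ∧ ∀ φ : C(ι → G, ℝ) →ₗ[ℝ] ℝ, φ 1 = 1 →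
        (∀ v ∈ s, 0 ≤ φ (v * v)) → |φ a| ≤ C := fun a => by
    by_cases ha : a ∈ polyAlgebra (ι := ι) r
    · obtain ⟨C, s, h1, h2⟩ := exists_finset_abs_le r ha
      exact ⟨C, s, fun _ => ⟨h1, h2⟩⟩
    · exact ⟨0, ∅, fun h => (ha h).elim⟩
  choose C s hCs using hb
  -- the truncated sequence of putative solutions, as points of the product space
  let good : ℕ → C(ι → G, ℝ) → Prop := fun n a => a ∈ polyAlgebra (ι := ι) r ∧ ∀ v ∈ s a, v ∈ V n
  let Φ : ℕ → (C(ι → G, ℝ) → ℝ) := fun n a => if good n a then φ n a else 0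
  have hgood : ∀ a ∈ polyAlgebra (ι := ι) r, ∀ᶠ n in atTop, good n a := fun a ha => by
    have h : ∀ᶠ n in atTop, ∀ v ∈ s a, v ∈ V n :=
      (Filter.eventually_all_finset (s a)).2 fun v hv => hex v ((hCs a ha).1 v hv)
    exact h.mono fun n hn => ⟨ha, hn⟩
  have hΦeq : ∀ a ∈ polyAlgebra (ι := ι) r, ∀ᶠ n in atTop, Φ n a = φ n a := fun a ha =>
    (hgood a ha).mono fun n hn => if_pos hn
  -- it lives in a compact box (Tychonoff)
  set B : Set (C(ι → G, ℝ) → ℝ) := Set.univ.pi fun a => Set.Icc (-|C a|) |C a| with hB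
  have hBc : IsCompact B := isCompact_univ_pi fun a => isCompact_Icc
  have hΦB : ∀ n, Φ n ∈ B := fun n => Set.mem_univ_pi.2 fun a => by
    by_cases hg : good n a
    · have h := (hCs a hg.1).2 (φ n) (hφ n).1 fun v hv => (hφ n).2.1 v (hg.2 v hv)
      have h' : |Φ n a| ≤ |C a| := by
        simp only [Φ, if_pos hg]
        exact h.trans (le_abs_self _)
      exact ⟨(abs_le.1 h').1, (abs_le.1 h').2⟩
    · simp only [Φ, if_neg hg, Set.mem_Icc, Left.neg_nonpos_iff, abs_nonneg, and_self]
  -- a cluster point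
  obtain ⟨x, -, hx⟩ := hBc.exists_clusterPt (f := map Φ atTop)
    (le_principal_iff.2 (mem_map.2 (Eventually.of_forall hΦB)))
  have key : ∀ {T : Set (C(ι → G, ℝ) → ℝ)}, IsClosed T → (∀ᶠ n in atTop, Φ n ∈ T) → x ∈ T :=
    fun hT hev => mem_of_clusterPt_map hx hT hev
  -- the cluster point solves every untruncated constraint
  have hx1 : x 1 = 1 := by
    refine key (T := {y | y 1 = 1}) (isClosed_eq (continuous_apply _) continuous_const) ?_
    filter_upwards [hΦeq 1 (polyAlgebra (ι := ι) r).one_mem] with n h1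
    simp only [h1]
    exact (hφ n).1
  have hxadd : ∀ a ∈ polyAlgebra (ι := ι) r, ∀ b ∈ polyAlgebra (ι := ι) r,
      x (a + b) = x a + x b := fun a ha b hb => by
    refine key (T := {y | y (a + b) = y a + y b})
      (isClosed_eq (continuous_apply _) ((continuous_apply a).add (continuous_apply b))) ?_
    filter_upwards [hΦeq a ha, hΦeq b hb, hΦeq (a + b) ((polyAlgebra (ι := ι) r).add_mem ha hb)]
      with n h1 h2 h3
    simp only [h1, h2, h3, map_add]
  have hxsmul : ∀ (c : ℝ), ∀ a ∈ polyAlgebra (ι := ι) r, x (c • a) = c * x a := fun c a ha => by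
    refine key (T := {y | y (c • a) = c * y a})
      (isClosed_eq (continuous_apply _) (continuous_const.mul (continuous_apply a))) ?_
    filter_upwards [hΦeq a ha, hΦeq (c • a) ((polyAlgebra (ι := ι) r).smul_mem ha c)] with n h1 h2
    simp only [h1, h2, map_smul, smul_eq_mul]
  have hxpos : ∀ v ∈ polyAlgebra (ι := ι) r, 0 ≤ x (v * v) := fun v hv => by
    refine key (T := {y | 0 ≤ y (v * v)}) (isClosed_le continuous_const (continuous_apply _)) ?_
    filter_upwards [hΦeq (v * v) ((polyAlgebra (ι := ι) r).mul_mem hv hv), hex v hv] with n h1 h2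
    simp only [h1]
    exact (hφ n).2.1 v h2
  have hxsd : ∀ (i : ι) (a : K), ∀ f ∈ polyAlgebra (ι := ι) r, ∀ f' ∈ polyAlgebra (ι := ι) r,
      (∀ U, HasDerivAt (fun t => f (Function.update U i (k a t * U i))) (f' U) 0) →
        x f' = β * x (f * S' i a) := fun i a f hf f' hf' hd => by
    refine key (T := {y | y f' = β * y (f * S' i a)})
      (isClosed_eq (continuous_apply _) (continuous_const.mul (continuous_apply _))) ?_
    filter_upwards [hΦeq f' hf', hΦeq (f * S' i a) ((polyAlgebra (ι := ι) r).mul_mem hf (hS'm i a)),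
      hex f hf] with n h1 h2 h3
    simp only [h1, h2]
    obtain ⟨S'', -, hS''d, hrows⟩ := (hφ n).2.2 i a
    have he : S'' = S' i a := ContinuousMap.ext fun U => (hS''d U).unique (hS'd i a U)
    rw [← he]
    exact hrows f h3 f' hf' hd
  -- NEW: the cluster point inherits every imposed invariance
  have hxinv : ∀ R ∈ 𝓡, ∀ a ∈ polyAlgebra (ι := ι) r, x (a.comp R) = x a := fun R hR a ha => by
    refine key (T := {y | y (a.comp R) = y a})
      (isClosed_eq (continuous_apply _) (continuous_apply _)) ?_
    filter_upwards [hΦeq a ha, hΦeq (a.comp R) (h𝓡 R hR a ha), hex a ha] with n h1 h2 h3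
    simp only [h1, h2]
    exact hinv n R hR a h3
  have hxfar : ∀ ψ : C(ι → G, ℝ) →ₗ[ℝ] ℝ,
      IsBootstrapFeasible r k S β (polyAlgebra (ι := ι) r : Set C(ι → G, ℝ)) ψ →
      (∀ R ∈ 𝓡, ∀ a ∈ polyAlgebra (ι := ι) r, ψ (a.comp R) = ψ a) → ε ≤ |x P - ψ P| :=
    fun ψ hψ hψinv => by
    refine key (T := {y | ε ≤ |y P - ψ P|})
      (isClosed_le continuous_const ((continuous_apply P).sub continuous_const).abs) ?_
    filter_upwards [hΦeq P hP] with n h1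
    simp only [h1]
    exact (hfar n ψ hψ hψinv).le
  -- the cluster point IS an invariant untruncated solution: contradiction
  let ψ₀ : Subalgebra.toSubmodule (polyAlgebra (ι := ι) r) →ₗ[ℝ] ℝ :=
    { toFun := fun a => x a
      map_add' := fun a b => hxadd a a.2 b b.2
      map_smul' := fun c a => by simpa using hxsmul c a a.2 }
  obtain ⟨ψ, hψ⟩ := LinearMap.exists_extend ψ₀
  have hψa : ∀ a ∈ polyAlgebra (ι := ι) r, ψ a = x a := fun a ha => by
    have h := LinearMap.congr_fun hψ ⟨a, ha⟩
    simpa [ψ₀] using h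
  have hψfeas : IsBootstrapFeasible r k S β (polyAlgebra (ι := ι) r : Set C(ι → G, ℝ)) ψ := by
    refine ⟨by rw [hψa 1 (polyAlgebra (ι := ι) r).one_mem, hx1], fun v hv => ?_, fun i a => ?_⟩
    · rw [hψa _ ((polyAlgebra (ι := ι) r).mul_mem hv hv)]
      exact hxpos v hv
    · refine ⟨S' i a, hS'm i a, hS'd i a, fun f hf f' hf' hd => ?_⟩
      rw [hψa f' hf', hψa _ ((polyAlgebra (ι := ι) r).mul_mem hf (hS'm i a))]
      exact hxsd i a f hf f' hf' hd
  have hψinv : ∀ R ∈ 𝓡, ∀ a ∈ polyAlgebra (ι := ι) r, ψ (a.comp R) = ψ a := fun R hR a ha => by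
    rw [hψa a ha, hψa _ (h𝓡 R hR a ha)]
    exact hxinv R hR a ha
  have h := hxfar ψ hψfeas hψinv
  rw [hψa P hP, sub_self, abs_zero] at h
  exact absurd h (not_le.2 hε)

end General

/-! ## `SU(N)` on `ℤ^d`: the reduced hierarchy and the translation-invariant Gibbs states -/

section ZdSuN

variable {d : ℕ} (N : ℕ) (β : ℝ)

/-- **Translation invariance of a measure from invariance of its polynomial moments.** -/
theorem isZdTranslationInvariant_of_forall_poly
    {μ : Measure (LGConfig d (Matrix.specialUnitaryGroup (Fin N) ℂ))} [IsFiniteMeasure μ]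
    (h : ∀ (v : Fin d → ℤ), ∀ a ∈ polyAlgebra (ι := ZdEdge d) (fundamentalLatticeRep N),
      ∫ U, a (relabelCM (G := Matrix.specialUnitaryGroup (Fin N) ℂ) (edgeShift v) U) ∂μ = ∫ U, a U ∂μ) :
    IsZdTranslationInvariant μ := by
  intro v
  refine eq_of_forall_integral_poly_eq (fundamentalLatticeRep N) _ _ fun a ha => ?_
  rw [integral_map_equiv]
  have he : ∀ U : LGConfig d (Matrix.specialUnitaryGroup (Fin N) ℂ),
      configShift v U = relabelCM (G := Matrix.specialUnitaryGroup (Fin N) ℂ) (edgeShift (-v)) U := fun U => by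
    rw [relabelCM_edgeShift_eq_configShift, neg_neg]
  simp only [he]
  exact h (-v) a ha

/-- ★★★ **The translation-reduced bootstrap on `ℤ^d` converges to the translation-invariant Gibbs
states.** `SU(N)`, any `d`, any real `β`: for every polynomial observable `P` and `ε > 0` there is
a level `n` such that every value of the translation-reduced level-`n` SDP (level-`n` feasible,
translation invariant on the words of length `≤ 2n`) lies within `ε` of `∫ P dμ` for some
TRANSLATION-INVARIANT infinite-volume Gibbs state `μ` of the Wilson action at `β`. [folklore] -/
theorem symBootstrap_convergence_dlr_suN
    {P : C(LGConfig d (Matrix.specialUnitaryGroup (Fin N) ℂ), ℝ)}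
    (hP : P ∈ polyAlgebra (ι := ZdEdge d) (fundamentalLatticeRep N)) {ε : ℝ} (hε : 0 < ε) :
    ∃ n, ∀ t ∈ symLevelValuesZdSuN (d := d) N β n P,
      ∃ μ ∈ ymGibbsMeasures (d := d) (fundamentalRep (Fin N)) β,
        IsZdTranslationInvariant μ ∧ |t - ∫ U, P U ∂μ| ≤ ε := by
  obtain ⟨n, hn⟩ := bootstrap_convergence_invariant (fundamentalLatticeRep N) (suExp_add N)
    (X := fun X : SuGenerator N => (X : Matrix (Fin N) (Fin N) ℂ)) (rho_suExp N)
    (S := fun e => wilsonBoundaryAction (fundamentalRep (Fin N)) {e}) (β := β)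
    (fun e => wilsonBoundaryAction_mem_polyFunctions (fundamentalLatticeRep N) {e})
    (fun n => wordTruncation (ι := ZdEdge d) (fundamentalLatticeRep N) n)
    (fun a ha => eventually_mem_wordTruncation (fundamentalLatticeRep N) ha)
    (Set.range fun v : Fin d → ℤ => relabelCM (G := Matrix.specialUnitaryGroup (Fin N) ℂ) (edgeShift v))
    (by
      rintro _ ⟨v, rfl⟩ a ha
      exact comp_relabelCM_mem_polyAlgebra (fundamentalLatticeRep N) _ ha)
    hP hε
  refine ⟨n, ?_⟩
  rintro t ⟨φ, hφ, hinv, rfl⟩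
  obtain ⟨ψ, hψ, hψinv, hclose⟩ := hn φ hφ (by
    rintro _ ⟨v, rfl⟩ a ha
    exact hinv v a (wordTruncation_mono _ (Nat.le_add_right n n) ha))
  obtain ⟨μ, hμ, hψμ⟩ := exists_dlr_of_bootstrap_suN N β hψ.1 hψ.2.1 hψ.2.2
  haveI := hμ.1
  refine ⟨μ, hμ, isZdTranslationInvariant_of_forall_poly N fun v a ha => ?_, ?_⟩
  · have h1 := hψμ a ha
    have h2 := hψμ _ (comp_relabelCM_mem_polyAlgebra (fundamentalLatticeRep N)
      (edgeShift v) ha)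
    have h3 := hψinv _ ⟨v, rfl⟩ a ha
    simp only [ContinuousMap.comp_apply] at h2
    rw [← h2, ← h1]
    exact h3
  · rwa [hψμ P hP] at hclose

/-- ★★ **Corollary (values of the reduced SDP squeeze onto the homogeneous phases)**: with
soundness, for `n` large the reduced level-`n` values of `P` and the set
`{∫ P dμ : μ translation-invariant Gibbs}` are within Hausdorff distance `ε`. Stated as: every
reduced value is `ε`-close to an invariant Gibbs value, and every invariant Gibbs value IS a
reduced value. -/
theorem symLevelValuesZd_hausdorff_suN
    {P : C(LGConfig d (Matrix.specialUnitaryGroup (Fin N) ℂ), ℝ)}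
    (hP : P ∈ polyAlgebra (ι := ZdEdge d) (fundamentalLatticeRep N)) {ε : ℝ} (hε : 0 < ε) :
    ∃ n, (∀ t ∈ symLevelValuesZdSuN (d := d) N β n P,
        ∃ μ ∈ ymGibbsMeasures (d := d) (fundamentalRep (Fin N)) β,
          IsZdTranslationInvariant μ ∧ |t - ∫ U, P U ∂μ| ≤ ε) ∧
      ∀ μ ∈ ymGibbsMeasures (d := d) (fundamentalRep (Fin N)) β, IsZdTranslationInvariant μ →
        ∫ U, P U ∂μ ∈ symLevelValuesZdSuN (d := d) N β n P := by
  obtain ⟨n, hn⟩ := symBootstrap_convergence_dlr_suN N β hP hε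
  exact ⟨n, hn, fun μ hμ hT => dlr_integral_mem_symLevelValuesZd N β n hμ hT P⟩

/-! ### Translation-invariant Gibbs states by averaging -/

/-- ★★ **Averaging a Gibbs state over the translations gives a translation-invariant Gibbs state**
(`SU(N)` on `ℤ^d`, any real `β`): for every DLR state `μ` there is a translation-invariant DLR state
`ν` whose polynomial expectations are the invariant means of the translates,
`∫ a dν = zdMean (v ↦ ∫ a ∘ τ_v dμ)`. Route: the translation average of the expectation functional
is an untruncated bootstrap solution (`isBootstrapFeasible_translationAvg`, all orbits bounded by
sup norms), realised by a DLR state (`exists_dlr_of_bootstrap_suN`), invariant by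
`isZdTranslationInvariant_of_forall_poly`. [cite: Georgii2011, Ch. 5 (shift-invariant Gibbs
measures; averaging)] -/
theorem exists_translationInvariant_dlr_of_dlr_suN
    {μ : Measure (LGConfig d (Matrix.specialUnitaryGroup (Fin N) ℂ))}
    (hμ : μ ∈ ymGibbsMeasures (d := d) (fundamentalRep (Fin N)) β) :
    ∃ ν ∈ ymGibbsMeasures (d := d) (fundamentalRep (Fin N)) β, IsZdTranslationInvariant ν ∧
      ∀ a ∈ polyAlgebra (ι := ZdEdge d) (fundamentalLatticeRep N),
        ∫ U, a U ∂ν = zdMean d fun v => ∫ U, a (relabelCM (G := Matrix.specialUnitaryGroup (Fin N) ℂ) (edgeShift v) U) ∂μ := by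
  haveI := hμ.1
  set φ := expectationFunctional μ with hφdef
  have hφ : IsBootstrapFeasible (fundamentalLatticeRep N) (suExp N)
      (fun e => wilsonBoundaryAction (fundamentalRep (Fin N)) {e}) β
      (polyAlgebra (ι := ZdEdge d) (fundamentalLatticeRep N) : Set _) φ :=
    isBootstrapFeasible_dlr_suN N β hμ subset_rfl
  -- every observable has a bounded orbit under an expectation functional
  have hbdd : ∀ x : C(LGConfig d (Matrix.specialUnitaryGroup (Fin N) ℂ), ℝ), x ∈ orbitBounded φ := fun x => by
    refine ⟨‖x‖, fun v => ?_⟩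
    rw [orbitFn_apply, hφdef, expectationFunctional_apply]
    refine (abs_integral_le_integral_abs).trans ?_
    have h : ∫ U, |(x.comp (relabelCM (G := Matrix.specialUnitaryGroup (Fin N) ℂ) (edgeShift v))) U| ∂μ ≤ ∫ _, ‖x‖ ∂μ :=
      integral_mono (integrable_of_continuous_compact
          (continuous_abs.comp (ContinuousMap.continuous _)) μ) (integrable_const _)
        fun U => by
          rw [← Real.norm_eq_abs]
          exact ContinuousMap.norm_coe_le_norm x _
    simpa using h
  have hψ := isBootstrapFeasible_translationAvg (fundamentalLatticeRep N)
    (wilsonBoundaryAction_translationCovariant_suN N)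
    (V := (polyAlgebra (ι := ZdEdge d) (fundamentalLatticeRep N) : Set _))
    (fun v x hx => comp_relabelCM_mem_polyAlgebra (fundamentalLatticeRep N) _ hx) hφ
    (fun w _ => hbdd (w * w))
  obtain ⟨ν, hν, hψν⟩ := exists_dlr_of_bootstrap_suN N β hψ.1 hψ.2.1 hψ.2.2
  haveI := hν.1
  refine ⟨ν, hν, isZdTranslationInvariant_of_forall_poly N fun v a ha => ?_, fun a ha => ?_⟩
  · rw [← hψν a ha, ← show (translationAvg φ) (a.comp (relabelCM (edgeShift v))) =
        ∫ U, a (relabelCM (G := Matrix.specialUnitaryGroup (Fin N) ℂ) (edgeShift v) U) ∂ν from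
      hψν _ (comp_relabelCM_mem_polyAlgebra (fundamentalLatticeRep N) _ ha)]
    exact translationAvg_comp φ (hbdd a) v
  · rw [← hψν a ha, translationAvg_apply φ (hbdd a)]
    rfl

/-- ★★ **Translation-invariant Gibbs states exist at every `β`** (`SU(N)` on `ℤ^d`; a second proof,
by averaging — the tree also obtains them as limits of torus states). -/
theorem exists_translationInvariant_dlr_suN :
    ∃ ν ∈ ymGibbsMeasures (d := d) (fundamentalRep (Fin N)) β, IsZdTranslationInvariant ν := by
  obtain ⟨μ, hμ⟩ := Literature.MathematicalPhysics.QuantumFieldTheory.ymGibbsMeasures_nonempty (d := d)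
    (fundamentalRep (Fin N)) (continuous_fundamentalRep _) β
  obtain ⟨ν, hν, hT, -⟩ := exists_translationInvariant_dlr_of_dlr_suN N β hμ
  exact ⟨ν, hν, hT⟩

end ZdSuN

end Summit.QuantumFields.GaugeBoot

end
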